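import Mathlib
import Literature.MathematicalPhysics.QuantumFieldTheory.Balaban1983to89.B6Prop23Chain
import Literature.MathematicalPhysics.QuantumFieldTheory.Balaban1983to89.B6Prop26
import Literature.MathematicalPhysics.QuantumFieldTheory.Balaban1983to89.B6Prop26Gluing
import Literature.MathematicalPhysics.QuantumFieldTheory.Balaban1983to89.B6Cor28
import Literature.MathematicalPhysics.QuantumFieldTheory.Balaban1983to89.B6Lemma21Repaired
import Literature.MathematicalPhysics.QuantumFieldTheory.Balaban1983to89.B6TowerSums

/-!
# `Balaban1983to89.B6Prop26ChainGeneric` — T. Bałaban, *Propagators and renormalization transformations for lattice gauge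
theories. II*, Commun. Math. Phys. **96** (1984) 223–250 [Balaban1984PropagatorsII]: the random-walk chain of
Proposition 2.2 ((2.64)–(2.66) p. 234), Proposition 2.6 ((2.136), (2.141) p. 247; the glueing (2.133) + (2.134) + (2.91))
and the composition of Corollary 2.8 (2.150)–(2.151) / (2.88), RE-DERIVED FOR AN ARBITRARY CONSTANT `c` IN THE ROW-SUM
BOUND (2.61) OF LEMMA 2.1 — so that the chain can be fed the REPAIRED Lemma 2.1′ (`B6Lemma21Repaired.Lemma21Repaired`,
c₁′ = 13c₀(½α)^{3d}) or the row sums PROVED on the multi-level tower family (`B6TowerSums.twGeo_ineq261With`, constant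
K_TW) instead of the printed `B6.Lemma21Printed` (c₁ = 12c₀(½α)^d), which is REFUTED AS TYPED on multi-level geometries
(GAPS G-B6-01a/b, `B6Lemma21Counterexample`, `B6Lemma21TowerD2`)

statement-level skeleton of published theorems with citation tags; proofs where landed; nothing here is a claim about the Yang–Mills mass gap.
PDF held: `paper:balaban1984-cmp96-propagators-rt-ii` (journal page = PDF page + 222); pp. 232–234 [PDF 10–12], 238 [PDF 16],
247 [PDF 25], 249 [PDF 27] are the pages quoted (the verbatim displays are the docstrings of the imported modules
`…B6RandomWalk` (unit pv08), `…B6Prop26` (pv01), `…B6Prop26Gluing` (pv09), `…B6Cor28` (pv01), which this file does NOT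
modify; block reader r03 certified those docstrings against the ×2 renders, `HOME/lit-balaban-r03/ROWS-B6.md`).

CITATION HEADER (cell `lit-balaban`, reader/typer + fold-owner seat `r03` (gen 8) = unit `lit-balaban-r03`, HOME
`run/shared/lean/pub/lit-balaban/`; SKELETON rows **`B6.Prop2.6`**, **`B6.Cor2.8`**, **`B6.Eq2.64`**, **`B6.Eq2.88`**
(cells only; no head changes) and the DEPGRAPH §2f «print-vs-tree tension» item *B6.Lem2.1 refuted-as-printed with proved
dependants* (lit-balaban-depgraph gen 14 → r03/ref-4)).  WHY THIS FILE: the owner's Lemma-2.1 CARRIAGE AUDIT of the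
B6 dependants (r03 gen 8) found that every proved dependant consumes Lemma 2.1 either in the GENERIC-constant displays
`B6Lemma21Repaired.Ineq261With c` / `Ineq263With c` ((2.68)/(2.69) `B6Ineq268`, (2.83) `B6Ineq283`, (2.88)
`B6Ineq288Edge.ineq288_of_printed`, Prop. 2.3 `B6Prop23*`, Prop. 2.7 `B6Prop27Kernel`, the DAG binder
`DagBinding.B6Lemma21Param`) or discharges the verbatim Lemma on one-scale families (`B6Lemma21TowerTorus.lemma21Printed_towerTorus`)
— EXCEPT the Proposition 2.2 / 2.6 / Corollary 2.8 fixed-point chain, whose theorems hard-wire the PRINTED constant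
`B6.c1 d δ α` (`B6RandomWalk.majorant_pow_265`, `majorant_G0_mul_265`, `majorant_partialSum_266`,
`majorant_of_fixedPoint_266`, `prop26_chain_2136`; `B6Prop26.prop26_entry_of_291` / `…_of_lemma21`;
`B6Prop26Gluing.prop26_2136_of_2133_2134(_lemma21)`; `B6Cor28.conv263_of_ineq263`, `conv3_of_ineq263`,
`cor28_entries_of_lemma21`, `ineq288_of_lemma21`).  Their proofs use of c₁ only that it is a non-negative real; this file
re-derives them with `B6.c1 d δ α ↦ c`, `0 ≤ c` on the generic core `B6Prop23Chain.majorant_of_fixedPoint_266W` (nothing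
else changes), then (§5) binds the repaired Lemma 2.1′ and
(§6) DISCHARGES the Lemma-2.1 inputs by name on the (k+1)-level tower family `B6LevelTower.twGeo`, where the printed
c₁ fails and the tower constant `B6TowerSums.Ktw d L (α·rate)` serves (2.61)/(2.63) uniformly in k.

WHAT IS PROVED (0 sorry, 0 defs, 0 new named facts; axioms standard):
§1 nothing new — the generic-constant core (2.64)–(2.66) (for any `c ≥ 0`: under θc < 1 the operator G′ = G′₀ + G′R has
   majorant A·c·(1 − θc)⁻¹·P(y)·e^{−(1−α)δd}) is already in the tree as `B6Prop23Chain.majorant_of_fixedPoint_266W`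
   (unit b06 g11, written for Prop. 2.3) and is consumed BY NAME.
§2 `prop26_chain_2136With` (Prop. 2.6 "reasoning in the same way", rate ½δ₂, constant A·c·(1 − θc)⁻¹, rate
   `B6RandomWalk.delta3 α δ₂`); `prop26_entry_of_291With`, `prop26_three_entries_of_291With` (the entries n = 0, 1, 3 of
   (2.136) for left factors D, from (2.91) + GΔ_a = I).
§3 `prop26_2136_of_2133_2134With` (the end-to-end glueing of `…B6Prop26Gluing` for any c).
§4 `conv263_of_ineq263With` (C_c = c²), `conv3_of_ineq263With` (C_c = c³), `cor28_entries_of_261With` (the first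
   conjunct of `B6.Cor28Printed` in shape, O(1) = C₁C₂L²c²), `ineq288_of_261With` (+ `ineq288_printed_of_261With`:
   (2.88) with O(1) = C₁C₂C₃·L⁴·L^d·L·c³) — from (2.60) `B6RandomWalk.Ineq260` and (2.61) `Ineq261With c` as the two
   displayed Lemma-2.1 inputs.
§5 the same with Lemma 2.1 TAKEN FROM THE TREE IN ITS REPAIRED FORM `B6Lemma21Repaired.Lemma21Repaired d δ geo`
   (c = c₁′ = `B6Lemma21Arith.c1Repaired d δ α`): `prop26_entry_of_lemma21Repaired`,
   `prop26_three_entries_of_lemma21Repaired`, `prop26_2136_of_2133_2134_lemma21Repaired`,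
   `cor28_entries_of_lemma21Repaired`, `ineq288_of_lemma21Repaired`.
§6 ON THE MULTI-LEVEL TOWER FAMILY `twGeo d k a m L η R` (every d ≥ 1, k, a, m, L ≥ 1, η, R): `prop26_chain_2136_tower`,
   `prop26_entry_of_291_tower`, `cor28_conv_tower`, and (v1.1, seat r03 gen 8) **`prop26_2136_of_2133_2134_tower`**
   (the end-to-end glueing (2.133) + (2.134) + (2.91) ⟹ (2.136) for ANY box family over the tower's 𝔅) — the
   Lemma-2.1 inputs (2.61)/(2.63) and the metric facts (2.54), d(y,y) = 0, d ≥ 0 DISCHARGED by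
   `B6TowerSums.twGeo_ineq261With`/`twGeo_ineq263With` and `B6LevelTower.twGeo_hyps266`; what remains hypothesis is
   exactly the OPERATOR data ((2.133)/(2.134)/(2.135)-majorants of G_□, K_{□,□′}, G₀, R and the algebra (2.91),
   GΔ_a = I) and the located smallness θ·K_TW < 1 (resp. N²θ₀·K_TW < 1).
HONEST SCOPE.  Nothing here proves (2.133), (2.134), (2.135), (2.91) or the kernel bounds of Cor. 2.8 — they stay the
displayed hypotheses they are in the imported modules; the file changes ONLY which form of Lemma 2.1 the chain binds.
The heads of rows B6.Prop2.6 (typed-existing) and B6.Cor2.8 / B6.Eq2.64 / B6.Eq2.88 (proved …) are unchanged.  Value =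
the §2f tension retired for the Prop 2.2/2.6/Cor 2.8 chain (no B6 kernel theorem of record needs the refuted printed
constant any more), NOT summit progress.
-/

namespace Literature.MathematicalPhysics.QuantumFieldTheory.Balaban1983to89.B6Prop26ChainGeneric

open Finset
open B6RandomWalk (Ineq260 Triangle254 HasMajorant hasMajorant_mono delta3)
open B6Prop23Chain (majorant_of_fixedPoint_266W)
open B6Lemma21Repaired (Ineq261With Ineq263With ineq263With_of_261With Lemma21Repaired c1Repaired_nonneg)
open B6Prop26 (fixedPoint_of_291 left_mul_fixedPoint)

/-! ## §1. (2.64)–(2.66) for an arbitrary (2.61)-constant `c` — ALREADY IN THE TREE, reused by name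

The generic-constant form of pv08's chain `B6RandomWalk.majorant_pow_265` / `majorant_G0_mul_265` /
`majorant_partialSum_266` / `majorant_of_fixedPoint_266` exists as `B6Prop23Chain.majorant_pow_265W` /
`majorant_G0_mul_265W` / `majorant_partialSum_266W` / `majorant_of_fixedPoint_266W` (cell pub-balaban, unit b06 g11,
written for Proposition 2.3's Neumann series); it is consumed below BY NAME (no restatement). -/


/-! ## §2. Proposition 2.6 — "reasoning in the same way as in the proof of Proposition 2.2", for any (2.61)-constant -/

section Prop26

variable {g : B6.Geometry} {X : Type}

/-- **Prop. 2.6, first entries of (2.136), by "reasoning in the same way as in the proof of Proposition 2.2"** (p. 247)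
for ANY constant `c ≥ 0` in (2.61)/(2.63) at the rate ½δ₂: if R has the (2.135)-majorant θe^{−½δ₂d} (θ = O(M⁻¹) ≥ 0),
G₀ = Σ_□ h_□G_□h_□ a majorant A·P(y)·e^{−½δ₂d} ((2.133)), θ·c < 1 and G = G₀ + GR ((2.91)/(2.141)), then G has the
majorant A·c·(1 − θc)⁻¹·P(y)·e^{−δ₃d(y,y′)}, δ₃ = `B6RandomWalk.delta3 α δ₂` = (1−α)·½δ₂.  The instance of
`B6Prop23Chain.majorant_of_fixedPoint_266W` at the rate ½δ₂ (pv08's `prop26_chain_2136` with c₁ ↦ c).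
[cite: Balaban1984PropagatorsII, Prop. 2.6 (2.136), (2.141) p.247] -/
theorem prop26_chain_2136With [Fintype X] [DecidableEq X] (blk : X → g.Site) (c δ₂ α θ A : ℝ)
    (P : g.Site → ℝ) (hc : 0 ≤ c) (hA : 0 ≤ A) (hP : ∀ y, 0 ≤ P y) (hθ : 0 ≤ θ) (hα : α ≤ 1) (hδ₂ : 0 ≤ δ₂)
    (htri : Triangle254 g) (hrefl : ∀ y : g.Site, g.dist y y = 0) (hdnn : ∀ y y' : g.Site, 0 ≤ g.dist y y')
    (h261 : Ineq261With c g (δ₂ / 2) α) (h263 : Ineq263With c g (δ₂ / 2) α) (hsmall : θ * c < 1)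
    {G G0 R : Module.End ℝ (X → ℝ)}
    (hG0 : HasMajorant blk G0 (fun a b => A * P a * Real.exp (-(δ₂ / 2 * g.dist a b))))
    (hR : HasMajorant blk R (fun a b => θ * Real.exp (-(δ₂ / 2 * g.dist a b)))) (hfix : G = G0 + G * R) :
    HasMajorant blk G (fun a b => A * c * (1 - θ * c)⁻¹ * P a * Real.exp (-(delta3 α δ₂ * g.dist a b))) := by
  have hαδ : 0 ≤ (1 - α) * (δ₂ / 2) := mul_nonneg (by linarith) (by linarith)
  have h := majorant_of_fixedPoint_266W blk c (δ₂ / 2) α θ A P hA hP hθ hc hαδ htri hrefl hdnn h261 h263 hsmall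
    hG0 hR hfix
  intro y' μ B hμ x
  have := h y' μ B hμ x
  simpa [delta3, mul_assoc] using this

/-- **One entry of (2.136) for a left factor D** (pv01's `B6Prop26.prop26_entry_of_291` with c₁ ↦ c): on a finite
lattice X with block map `blk : X → 𝔅`, if `G Δ_a = I`, `Δ_a G₀ = I − R` ((2.91)), `DG₀` has the block majorant
A·P(y)·e^{−δd(y,y′)} ((2.133) summed over the boxes, for the left factor D = I, ∇_μ, Δ) and `R` the block majorant
θe^{−δd(y,y′)} ((2.135)), then — given (2.61)/(2.63) at rate δ with ANY constant `c ≥ 0`, (2.54), d(y,y) = 0, d ≥ 0 and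
θc < 1 — `DG` has the block majorant A·c·(1 − θc)⁻¹·P(y)·e^{−(1−α)δd(y,y′)}: the (2.136) entry with δ₃ = (1−α)δ.
[cite: Balaban1984PropagatorsII, Prop. 2.6 (2.136) p.247; (2.91) p.239] -/
theorem prop26_entry_of_291With [Fintype X] [DecidableEq X] (blk : X → g.Site) (c δ α θ A : ℝ)
    (P : g.Site → ℝ) (hc : 0 ≤ c) (hA : 0 ≤ A) (hP : ∀ y, 0 ≤ P y) (hθ : 0 ≤ θ) (hαδ : 0 ≤ (1 - α) * δ)
    (htri : Triangle254 g) (hrefl : ∀ y : g.Site, g.dist y y = 0) (hdnn : ∀ y y' : g.Site, 0 ≤ g.dist y y')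
    (h261 : Ineq261With c g δ α) (h263 : Ineq263With c g δ α) (hsmall : θ * c < 1)
    {G G0 R Δa : Module.End ℝ (X → ℝ)} (D : Module.End ℝ (X → ℝ))
    (hinv : G * Δa = 1) (h291 : Δa * G0 = 1 - R)
    (hDG0 : HasMajorant blk (D * G0) (fun a b => A * P a * Real.exp (-(δ * g.dist a b))))
    (hR : HasMajorant blk R (fun a b => θ * Real.exp (-(δ * g.dist a b)))) :
    HasMajorant blk (D * G)
      (fun a b => A * c * (1 - θ * c)⁻¹ * P a * Real.exp (-((1 - α) * δ * g.dist a b))) :=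
  majorant_of_fixedPoint_266W blk c δ α θ A P hA hP hθ hc hαδ htri hrefl hdnn h261 h263 hsmall hDG0 hR
    (left_mul_fixedPoint D (fixedPoint_of_291 hinv h291))

/-- **The entries n = 0, 1, 3 of (2.136) simultaneously** (the printed table [(L^jη)², L^jη, ·, 1] = `B6.pref4`, the third
entry |(G∇*J)(x)| excepted — it is not of the left-factor form), for ANY constant `c ≥ 0` in (2.61)/(2.63) at rate δ
(pv01's `B6Prop26.prop26_three_entries_of_lemma21` with the Lemma-2.1 input generic): for left factors D₀ = 1, D₁, D₃
whose products with G₀ have block majorants A·[(L^jη)², L^jη, 1]·e^{−δd}, the products with G have block majorants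
A·c·(1 − θc)⁻¹·[(L^jη)², L^jη, 1]·e^{−(1−α)δd}. [cite: Balaban1984PropagatorsII, Prop. 2.6 (2.136) p.247] -/
theorem prop26_three_entries_of_291With [Fintype X] [DecidableEq X] (blk : X → g.Site) (c δ α θ A : ℝ)
    (hc : 0 ≤ c) (hA : 0 ≤ A) (hθ : 0 ≤ θ) (hαδ : 0 ≤ (1 - α) * δ)
    (htri : Triangle254 g) (hrefl : ∀ y : g.Site, g.dist y y = 0) (hdnn : ∀ y y' : g.Site, 0 ≤ g.dist y y')
    (h261 : Ineq261With c g δ α) (h263 : Ineq263With c g δ α) (hsmall : θ * c < 1)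
    (hL : 1 ≤ g.L) (hη : 0 < g.eta)
    {G G0 R Δa : Module.End ℝ (X → ℝ)} (D : Fin 4 → Module.End ℝ (X → ℝ)) (hD0 : D 0 = 1)
    (hinv : G * Δa = 1) (h291 : Δa * G0 = 1 - R)
    (hDG0 : ∀ n : Fin 4, n ≠ 2 → HasMajorant blk (D n * G0)
      (fun a b => A * B6.pref4 (g.len a) n * Real.exp (-(δ * g.dist a b))))
    (hR : HasMajorant blk R (fun a b => θ * Real.exp (-(δ * g.dist a b)))) :
    (HasMajorant blk G
      (fun a b => A * c * (1 - θ * c)⁻¹ * (g.len a) ^ 2 * Real.exp (-((1 - α) * δ * g.dist a b)))) ∧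
    (∀ n : Fin 4, n ≠ 2 → HasMajorant blk (D n * G)
      (fun a b => A * c * (1 - θ * c)⁻¹ * B6.pref4 (g.len a) n * Real.exp (-((1 - α) * δ * g.dist a b)))) := by
  have hlen : ∀ y : g.Site, 0 ≤ g.len y := fun y => by
    unfold B6.Geometry.len
    exact mul_nonneg (pow_nonneg (le_trans zero_le_one hL) _) hη.le
  have hpref : ∀ (n : Fin 4) (y : g.Site), 0 ≤ B6.pref4 (g.len y) n := by
    intro n y
    have h := hlen y
    fin_cases n <;> simp [B6.pref4] <;> positivity
  have hall : ∀ n : Fin 4, n ≠ 2 → HasMajorant blk (D n * G)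
      (fun a b => A * c * (1 - θ * c)⁻¹ * B6.pref4 (g.len a) n * Real.exp (-((1 - α) * δ * g.dist a b))) :=
    fun n hn => prop26_entry_of_291With blk c δ α θ A (fun y => B6.pref4 (g.len y) n) hc hA (hpref n) hθ hαδ htri
      hrefl hdnn h261 h263 hsmall (D n) hinv h291 (hDG0 n hn) hR
  refine ⟨?_, hall⟩
  have h0 := hall 0 (by decide)
  rw [hD0, one_mul] at h0
  refine hasMajorant_mono blk h0 fun a b => le_of_eq ?_
  simp [B6.pref4]

end Prop26

/-! ## §3. The end-to-end glueing (2.133) + (2.134) + (2.91) ⟹ (2.136), for any (2.61)-constant -/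

section Gluing

open B6Prop26Gluing (mulOp LocalMajorant OutLoc majorant_G0_of_2133 ineq2135_of_2134_291)

variable {g : B6.Geometry} {X : Type}

open Classical in
/-- **Prop. 2.6, entry |(GJ)(x)| of (2.136), from the PER-BOX inputs** (p. 247), for ANY constant `c ≥ 0` in
(2.61)/(2.63) at the rate ½δ₂ (pv09's `B6Prop26Gluing.prop26_2136_of_2133_2134` with c₁ ↦ c): boxes 𝒟 with reaches
S_□ of overlap number N, partition functions h_□ (|h_□| ≤ 1, supported within the blocks of S_□), box operators G_□
with the d-form local bound (2.133) A·P(y)·e^{−½δ₂d(y,y′)} on S_□, pair operators K_{□,□′}G_{□′} output-localised to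
S_□ with (2.134), G₀ = Σ_□ h_□G_□h_□, R = Σ_{□,□′} K_{□,□′}G_{□′}h_{□′}, (2.91) Δ_aG₀ = I − R and GΔ_a = I; then under the
located smallness N²θ₀·c < 1, G has the majorant (N·A)·c·(1 − N²θ₀c)⁻¹·P(y)·e^{−δ₃d(y,y′)}, δ₃ = `delta3 α δ₂`.
[cite: Balaban1984PropagatorsII, Prop. 2.6 (2.136) p.247; (2.91) p.239; (2.133)–(2.135) p.247] -/
theorem prop26_2136_of_2133_2134With [Fintype X] [DecidableEq X] (blk : X → g.Site) (c δ₂ α θ₀ A : ℝ)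
    (P : g.Site → ℝ) (hc : 0 ≤ c) (hA : 0 ≤ A) (hP : ∀ y, 0 ≤ P y) (hθ₀ : 0 ≤ θ₀) (hα : α ≤ 1) (hδ₂ : 0 ≤ δ₂)
    (htri : Triangle254 g) (hrefl : ∀ y : g.Site, g.dist y y = 0) (hdnn : ∀ y y' : g.Site, 0 ≤ g.dist y y')
    (h261 : Ineq261With c g (δ₂ / 2) α) (h263 : Ineq263With c g (δ₂ / 2) α)
    {C : Type} (D : Finset C) (S : C → Set g.Site) (N : ℕ)
    (hN : ∀ a : g.Site, (D.filter fun i => a ∈ S i).card ≤ N)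
    (hsmall : (N : ℝ) ^ 2 * θ₀ * c < 1)
    (h : C → X → ℝ) (hsupp : ∀ i ∈ D, ∀ x, h i x ≠ 0 → blk x ∈ S i) (hle : ∀ i ∈ D, ∀ x, |h i x| ≤ 1)
    (Gl : C → Module.End ℝ (X → ℝ))
    (h2133 : ∀ i ∈ D,
      LocalMajorant blk (Gl i) (S i) (fun a b => A * P a * Real.exp (-(δ₂ / 2 * g.dist a b))))
    (Kt : C → C → Module.End ℝ (X → ℝ))
    (h2134 : ∀ i ∈ D, ∀ i' ∈ D,
      HasMajorant blk (Kt i i' * mulOp (h i')) (fun a b => θ₀ * Real.exp (-(δ₂ / 2 * g.dist a b))))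
    (hKout : ∀ i ∈ D, ∀ i' ∈ D, OutLoc blk (Kt i i') (S i))
    {G G0 R Δa : Module.End ℝ (X → ℝ)}
    (hG0 : G0 = ∑ i ∈ D, mulOp (h i) * Gl i * mulOp (h i))
    (hR : R = ∑ i ∈ D, ∑ i' ∈ D, Kt i i' * mulOp (h i'))
    (hinv : G * Δa = 1) (h291 : Δa * G0 = 1 - R) :
    HasMajorant blk G (fun a b => (N * A) * c * (1 - (N : ℝ) ^ 2 * θ₀ * c)⁻¹ * P a *
      Real.exp (-(delta3 α δ₂ * g.dist a b))) := by
  have hK : ∀ a b, 0 ≤ A * P a * Real.exp (-(δ₂ / 2 * g.dist a b)) := fun a b =>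
    mul_nonneg (mul_nonneg hA (hP a)) (Real.exp_nonneg _)
  have hG0m : HasMajorant blk G0 (fun a b => N * A * P a * Real.exp (-(δ₂ / 2 * g.dist a b))) := by
    rw [hG0]
    refine hasMajorant_mono blk (majorant_G0_of_2133 blk D S N hN h hsupp hle Gl _ hK h2133)
      fun a b => le_of_eq ?_
    ring
  have hRm : HasMajorant blk R (fun a b => (N : ℝ) ^ 2 * θ₀ * Real.exp (-(δ₂ / 2 * g.dist a b))) :=
    ineq2135_of_2134_291 blk D S N hN h hsupp Kt δ₂ θ₀ hθ₀ h2134 hKout hR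
  have hfix : G = G0 + G * R := fixedPoint_of_291 hinv h291
  exact prop26_chain_2136With blk c δ₂ α ((N : ℝ) ^ 2 * θ₀) (N * A) P hc (mul_nonneg (Nat.cast_nonneg N) hA) hP
    (mul_nonneg (sq_nonneg _) hθ₀) hα hδ₂ htri hrefl hdnn h261 h263 hsmall hG0m hRm hfix

end Gluing

/-! ## §4. Corollary 2.8 (first conjunct) and (2.88) composed from (2.60) + (2.61) with any constant -/

section Cor28

open B6Cor28 (Conv263 Conv3 ScaleAbsorb KerBound136 KerBound149 compKer comp3 Ineq288 scaleAbsorb_of_260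
  cor28_first_conjunct_shape len_pos len_eq_rpow ineq288_kernel transfer_of_260)

/-- The one-intermediate-point convolution hypothesis of `B6Cor28.cor28_first_conjunct_shape` from (2.63) with ANY
constant (m = 1 of `Ineq263With c`): `C_c = c²`, `θ = (1−α)δ₀`. [cite: Balaban1984PropagatorsII, Lemma 2.1 (2.63) p.234] -/
theorem conv263_of_ineq263With (cL : ℝ) (g : B6.Geometry) (δ₀ α : ℝ) (h : Ineq263With cL g δ₀ α) :
    Conv263 g.dist δ₀ (cL ^ 2) ((1 - α) * δ₀) := by
  intro b c
  have h1 := h 1 b c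
  simpa [B6RandomWalk.chain] using h1

/-- The two-intermediate-point convolution hypothesis of `B6Cor28.ineq288_kernel` from (2.63) with ANY constant
(m = 2 of `Ineq263With c`): `C_c = c³`, `θ = (1−α)δ₀`. [cite: Balaban1984PropagatorsII, Lemma 2.1 (2.63) p.234] -/
theorem conv3_of_ineq263With (cL : ℝ) (g : B6.Geometry) (δ₀ α : ℝ) (h : Ineq263With cL g δ₀ α) :
    Conv3 g.dist δ₀ (cL ^ 3) ((1 - α) * δ₀) := by
  intro y y'
  have h2 := h 2 y y'
  simpa [B6RandomWalk.chain] using h2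

/-- **Cor. 2.8 (first conjunct, in shape) ⇐ the kernel form of (2.136) + (2.149) + (2.60) + (2.61) with ANY constant**
(pv01's `B6Cor28.cor28_entries_of_lemma21` with the Lemma-2.1 input generic): for one geometry with (2.60)
`Ineq260 g δ₀ α`, (2.61) `Ineq261With cL g δ₀ α`, the triangle inequality (2.54), 0 ≤ δ₀, α ≤ 1, `1 ≤ L`, `0 < η`,
`d ≥ 0` and the largeness `L² ≤ e^{αδ₀RM}`: if the kernels `K₁ n` (n = 0, 1) obey the (2.136)-type bounds with powers
(L^jη)^{2−n} and rate δ₃ ≥ (1+α)δ₀, and `K₂` obeys (2.149) with rate δ₄′ ≥ δ₀, then the (2.150)-kernels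
`compKer len d (K₁ n) K₂` of H, ∇H satisfy the first conjunct of `B6.Cor28Printed` in shape with δ₅ = (1−α)δ₀ and
O(1) = C₁C₂L²cL². [cite: Balaban1984PropagatorsII, Cor. 2.8 p.249; Lemma 2.1 p.234] -/
theorem cor28_entries_of_261With (g : B6.Geometry) (d : ℕ) (cL δ₀ α : ℝ) (hδ₀ : 0 ≤ δ₀) (hα1 : α ≤ 1)
    (htri : Triangle254 g) (h260 : Ineq260 g δ₀ α) (h261 : Ineq261With cL g δ₀ α)
    (hL : 1 ≤ g.L) (hη : 0 < g.eta) (hlarge : g.L ^ (2 : ℝ) ≤ Real.exp (α * δ₀ * g.R * g.M))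
    (hdist : ∀ y y', 0 ≤ g.dist y y')
    (K₁ : Fin 2 → g.Site → g.Site → ℝ) (K₂ : g.Site → g.Site → ℝ)
    (C₁ C₂ δ₃ δ₄' : ℝ) (hC₁ : 0 ≤ C₁) (hC₂ : 0 ≤ C₂) (hδ₃ : δ₀ + α * δ₀ ≤ δ₃) (hδ₄ : δ₀ ≤ δ₄')
    (hK₁ : ∀ n : Fin 2, KerBound136 g.len g.dist d (K₁ n) (2 - (n : ℝ)) C₁ δ₃)
    (hK₂ : KerBound149 g.len g.dist d K₂ C₂ δ₄') :
    ∀ (n : Fin 2) (y c : g.Site), |compKer g.len d (K₁ n) K₂ y c| ≤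
      C₁ * C₂ * g.L ^ (2 : ℝ) * cL ^ 2 * g.len y ^ (-(n : ℝ)) * g.len c ^ (-(d : ℝ)) *
        Real.exp (-((1 - α) * δ₀ * g.dist y c)) := by
  have h263 : Ineq263With cL g δ₀ α := ineq263With_of_261With htri hδ₀ hα1 h261
  have hconv := conv263_of_ineq263With cL g δ₀ α h263
  have habs : ScaleAbsorb g.len g.dist (α * δ₀) (g.L ^ (2 : ℝ)) := by
    rw [len_eq_rpow]
    exact scaleAbsorb_of_260 g.scale g.dist g.L g.eta (α * δ₀) g.R g.M hL hη hlarge h260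
  have hL2 : 0 ≤ g.L ^ (2 : ℝ) := Real.rpow_nonneg (le_trans zero_le_one hL) _
  exact cor28_first_conjunct_shape g d K₁ K₂ C₁ C₂ δ₃ δ₄' (α * δ₀) δ₀ (g.L ^ (2 : ℝ)) (cL ^ 2) ((1 - α) * δ₀)
    (len_pos g hL hη) hdist hC₁ hC₂ hL2 hδ₃ hδ₄ hK₁ hK₂ habs hconv

/-- **(2.88) composed from (2.60) + (2.61) with ANY constant** (pv01's `B6Cor28.ineq288_of_lemma21` with the Lemma-2.1
input generic; cf. the generic-constant edge `B6Ineq288Edge.ineq288_of_printed` of seat r03 g4, which packages the same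
composition over the typed Props 2.2/2.3): for one geometry with `Ineq260 g δ α`, `Ineq261With cL g δ α`, (2.54),
0 ≤ δ, 0 < α ≤ 1, `1 ≤ L`, `0 < η`, `d ≥ 0` and the largeness `L⁴, L^d, L ≤ e^{αδRM}`, three kernels bounded as in the
first inequality of (2.88) with rates `a, b, c′` satisfying `(1+2α)δ ≤ a`, `(1+α)δ ≤ b`, `(1+2α)δ ≤ c′` compose to the
printed right-hand side with δ₂ = (1−α)δ and O(1) = C₁C₂C₃·L⁴·L^d·L·cL³.
[cite: Balaban1984PropagatorsII, (2.88) p.238; Lemma 2.1 p.234] -/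
theorem ineq288_of_261With (g : B6.Geometry) (d : ℕ) (cL δ α : ℝ) (hδ : 0 ≤ δ) (hα0 : 0 < α) (hα1 : α ≤ 1)
    (htri : Triangle254 g) (h260 : Ineq260 g δ α) (h261 : Ineq261With cL g δ α)
    (hL : 1 ≤ g.L) (hη : 0 < g.eta)
    (hl4 : g.L ^ (4 : ℝ) ≤ Real.exp (α * δ * g.R * g.M))
    (hld : g.L ^ (d : ℝ) ≤ Real.exp (α * δ * g.R * g.M))
    (hl1 : g.L ^ (1 : ℝ) ≤ Real.exp (α * δ * g.R * g.M))
    (hdist : ∀ y y', 0 ≤ g.dist y y')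
    (K₁ K₂ K₃ : g.Site → g.Site → ℝ) (C₁ C₂ C₃ a b c' : ℝ)
    (hC₁ : 0 ≤ C₁) (hC₂ : 0 ≤ C₂) (hC₃ : 0 ≤ C₃)
    (ha : δ + 2 * (α * δ) ≤ a) (hb : δ + α * δ ≤ b) (hc : δ + 2 * (α * δ) ≤ c')
    (hK₁ : ∀ y y₁, |K₁ y y₁| ≤ C₁ * g.len y ^ (1 : ℝ) * Real.exp (-(a * g.dist y y₁)))
    (hK₂ : ∀ y₁ y₂, |K₂ y₁ y₂| ≤ C₂ * g.len y₁ ^ (-(4 : ℝ)) * g.len y₂ ^ (-(d : ℝ)) *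
      Real.exp (-(b * g.dist y₁ y₂)))
    (hK₃ : ∀ y₂ y', |K₃ y₂ y'| ≤ C₃ * g.len y' ^ (1 : ℝ) * Real.exp (-(c' * g.dist y₂ y'))) :
    ∀ y y' : g.Site, |comp3 K₁ K₂ K₃ y y'| ≤
      C₁ * C₂ * C₃ * g.L ^ (4 : ℝ) * g.L ^ (d : ℝ) * g.L ^ (1 : ℝ) * cL ^ 3 *
        g.len y ^ (-(2 : ℝ)) * g.len y' ^ (-(d : ℝ)) * Real.exp (-((1 - α) * δ * g.dist y y')) := by
  intro y y'
  have h263 : Ineq263With cL g δ α := ineq263With_of_261With htri hδ hα1 h261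
  have hconv := conv3_of_ineq263With cL g δ α h263
  have hL0 : 0 ≤ g.L := le_trans zero_le_one hL
  have e4 : |(-(4 : ℝ))| = 4 := by norm_num
  have ed : |(-(d : ℝ))| = (d : ℝ) := by rw [abs_neg]; exact abs_of_nonneg (Nat.cast_nonneg d)
  have e1 : |(1 : ℝ)| = 1 := abs_one
  have hT₄ := (transfer_of_260 g.scale g.dist g.L g.eta (α * δ) g.R g.M (-(4 : ℝ)) hL hη
    (by rw [e4]; exact hl4) h260).2
  have hTd := (transfer_of_260 g.scale g.dist g.L g.eta (α * δ) g.R g.M (-(d : ℝ)) hL hη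
    (by rw [ed]; exact hld) h260).1
  have hT₁ := (transfer_of_260 g.scale g.dist g.L g.eta (α * δ) g.R g.M (1 : ℝ) hL hη
    (by rw [e1]; exact hl1) h260).2
  rw [e4] at hT₄
  rw [ed] at hTd
  rw [e1] at hT₁
  rw [← len_eq_rpow] at hT₄ hTd hT₁
  have hε : 0 ≤ α * δ := mul_nonneg hα0.le hδ
  exact ineq288_kernel g.len g.dist d K₁ K₂ K₃ C₁ C₂ C₃ a b c' (α * δ) δ (g.L ^ (4 : ℝ)) (g.L ^ (d : ℝ))
    (g.L ^ (1 : ℝ)) (cL ^ 3) ((1 - α) * δ) (len_pos g hL hη) hdist htri hC₁ hC₂ hC₃ (Real.rpow_nonneg hL0 _)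
    (Real.rpow_nonneg hL0 _) (Real.rpow_nonneg hL0 _) hε ha hb hc hK₁ hK₂ hK₃ hT₄ hTd hT₁ hconv y y'

/-- `ineq288_of_261With` in the shape `B6Cor28.Ineq288`: δ₂ = (1−α)δ, O(1) = C₁C₂C₃·L⁴·L^d·L·cL³.
[cite: Balaban1984PropagatorsII, (2.88) p.238; Lemma 2.1 p.234] -/
theorem ineq288_printed_of_261With (g : B6.Geometry) (d : ℕ) (cL δ α : ℝ) (hδ : 0 ≤ δ) (hα0 : 0 < α) (hα1 : α ≤ 1)
    (htri : Triangle254 g) (h260 : Ineq260 g δ α) (h261 : Ineq261With cL g δ α)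
    (hL : 1 ≤ g.L) (hη : 0 < g.eta)
    (hl4 : g.L ^ (4 : ℝ) ≤ Real.exp (α * δ * g.R * g.M))
    (hld : g.L ^ (d : ℝ) ≤ Real.exp (α * δ * g.R * g.M))
    (hl1 : g.L ^ (1 : ℝ) ≤ Real.exp (α * δ * g.R * g.M))
    (hdist : ∀ y y', 0 ≤ g.dist y y')
    (K₁ K₂ K₃ : g.Site → g.Site → ℝ) (C₁ C₂ C₃ a b c' : ℝ)
    (hC₁ : 0 ≤ C₁) (hC₂ : 0 ≤ C₂) (hC₃ : 0 ≤ C₃)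
    (ha : δ + 2 * (α * δ) ≤ a) (hb : δ + α * δ ≤ b) (hc : δ + 2 * (α * δ) ≤ c')
    (hK₁ : ∀ y y₁, |K₁ y y₁| ≤ C₁ * g.len y ^ (1 : ℝ) * Real.exp (-(a * g.dist y y₁)))
    (hK₂ : ∀ y₁ y₂, |K₂ y₁ y₂| ≤ C₂ * g.len y₁ ^ (-(4 : ℝ)) * g.len y₂ ^ (-(d : ℝ)) *
      Real.exp (-(b * g.dist y₁ y₂)))
    (hK₃ : ∀ y₂ y', |K₃ y₂ y'| ≤ C₃ * g.len y' ^ (1 : ℝ) * Real.exp (-(c' * g.dist y₂ y'))) :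
    Ineq288 g d K₁ K₂ K₃ (C₁ * C₂ * C₃ * g.L ^ (4 : ℝ) * g.L ^ (d : ℝ) * g.L ^ (1 : ℝ) * cL ^ 3) ((1 - α) * δ) :=
  fun y y' => ineq288_of_261With g d cL δ α hδ hα0 hα1 htri h260 h261 hL hη hl4 hld hl1 hdist K₁ K₂ K₃ C₁ C₂ C₃ a b c'
    hC₁ hC₂ hC₃ ha hb hc hK₁ hK₂ hK₃ y y'

end Cor28

/-! ## §5. The chain bound to the REPAIRED Lemma 2.1′ of the tree (`B6Lemma21Repaired.Lemma21Repaired`) -/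

section Repaired

variable {I : Type}

open B6Prop26Gluing (mulOp LocalMajorant OutLoc)
open B6Cor28 (KerBound136 KerBound149 compKer comp3 Ineq288)

/-- **One entry of (2.136) with Lemma 2.1 TAKEN FROM THE TREE IN ITS REPAIRED FORM**: for a geometry of a family
satisfying `B6Lemma21Repaired.Lemma21Repaired d δ geo` (c₁′ = 13c₀(½α)^{3d}; rate δ ≥ 0) and the triangle inequality
(2.54), under (2.1)–(2.2), 0 < α < 1 and (2.59), the inputs (2.61′)/(2.63′) of `prop26_entry_of_291With` are DISCHARGED
(`B6Lemma21Repaired.ineq263With_of_261With`). [cite: Balaban1984PropagatorsII, Prop. 2.6 p.247; Lemma 2.1 p.234; repaired] -/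
theorem prop26_entry_of_lemma21Repaired (d : ℕ) (δ : ℝ) (hδ : 0 ≤ δ) (geo : I → B6.Geometry)
    (h21 : Lemma21Repaired d δ geo) (i : I) (htri : Triangle254 (geo i))
    (hrefl : ∀ y : (geo i).Site, (geo i).dist y y = 0) (hdnn : ∀ y y' : (geo i).Site, 0 ≤ (geo i).dist y y')
    (hH : (geo i).Hyp21_22) (α : ℝ) (hα0 : 0 < α) (hα1 : α < 1)
    (h259 : B6.Cond259 d δ α (geo i).R (geo i).M)
    {X : Type} [Fintype X] [DecidableEq X] (blk : X → (geo i).Site) (θ A : ℝ) (P : (geo i).Site → ℝ)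
    (hA : 0 ≤ A) (hP : ∀ y, 0 ≤ P y) (hθ : 0 ≤ θ) (hsmall : θ * B6Lemma21Arith.c1Repaired d δ α < 1)
    {G G0 R Δa : Module.End ℝ (X → ℝ)} (D : Module.End ℝ (X → ℝ))
    (hinv : G * Δa = 1) (h291 : Δa * G0 = 1 - R)
    (hDG0 : HasMajorant blk (D * G0) (fun a b => A * P a * Real.exp (-(δ * (geo i).dist a b))))
    (hR : HasMajorant blk R (fun a b => θ * Real.exp (-(δ * (geo i).dist a b)))) :
    HasMajorant blk (D * G)
      (fun a b => A * B6Lemma21Arith.c1Repaired d δ α * (1 - θ * B6Lemma21Arith.c1Repaired d δ α)⁻¹ * P a *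
        Real.exp (-((1 - α) * δ * (geo i).dist a b))) := by
  have h261 : Ineq261With (B6Lemma21Arith.c1Repaired d δ α) (geo i) δ α := (h21 i hH α hα0 hα1 h259).2
  have h263 : Ineq263With (B6Lemma21Arith.c1Repaired d δ α) (geo i) δ α :=
    ineq263With_of_261With htri hδ hα1.le h261
  have hαδ : 0 ≤ (1 - α) * δ := mul_nonneg (by linarith) hδ
  exact prop26_entry_of_291With blk _ δ α θ A P (c1Repaired_nonneg d δ α) hA hP hθ hαδ htri hrefl hdnn h261 h263
    hsmall D hinv h291 hDG0 hR

/-- **The entries n = 0, 1, 3 of (2.136) with the REPAIRED Lemma 2.1′ of the tree** (pv01's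
`B6Prop26.prop26_three_entries_of_lemma21` with `B6.Lemma21Printed` ↦ `B6Lemma21Repaired.Lemma21Repaired`, c₁ ↦ c₁′).
[cite: Balaban1984PropagatorsII, Prop. 2.6 (2.136) p.247; Lemma 2.1 p.234; repaired] -/
theorem prop26_three_entries_of_lemma21Repaired (d : ℕ) (δ : ℝ) (hδ : 0 ≤ δ) (geo : I → B6.Geometry)
    (h21 : Lemma21Repaired d δ geo) (i : I) (htri : Triangle254 (geo i))
    (hrefl : ∀ y : (geo i).Site, (geo i).dist y y = 0) (hdnn : ∀ y y' : (geo i).Site, 0 ≤ (geo i).dist y y')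
    (hH : (geo i).Hyp21_22) (α : ℝ) (hα0 : 0 < α) (hα1 : α < 1)
    (h259 : B6.Cond259 d δ α (geo i).R (geo i).M) (hL : 1 ≤ (geo i).L) (hη : 0 < (geo i).eta)
    {X : Type} [Fintype X] [DecidableEq X] (blk : X → (geo i).Site) (θ A : ℝ)
    (hA : 0 ≤ A) (hθ : 0 ≤ θ) (hsmall : θ * B6Lemma21Arith.c1Repaired d δ α < 1)
    {G G0 R Δa : Module.End ℝ (X → ℝ)} (D : Fin 4 → Module.End ℝ (X → ℝ)) (hD0 : D 0 = 1)
    (hinv : G * Δa = 1) (h291 : Δa * G0 = 1 - R)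
    (hDG0 : ∀ n : Fin 4, n ≠ 2 → HasMajorant blk (D n * G0)
      (fun a b => A * B6.pref4 ((geo i).len a) n * Real.exp (-(δ * (geo i).dist a b))))
    (hR : HasMajorant blk R (fun a b => θ * Real.exp (-(δ * (geo i).dist a b)))) :
    (HasMajorant blk G
      (fun a b => A * B6Lemma21Arith.c1Repaired d δ α * (1 - θ * B6Lemma21Arith.c1Repaired d δ α)⁻¹ *
        ((geo i).len a) ^ 2 * Real.exp (-((1 - α) * δ * (geo i).dist a b)))) ∧
    (∀ n : Fin 4, n ≠ 2 → HasMajorant blk (D n * G)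
      (fun a b => A * B6Lemma21Arith.c1Repaired d δ α * (1 - θ * B6Lemma21Arith.c1Repaired d δ α)⁻¹ *
        B6.pref4 ((geo i).len a) n * Real.exp (-((1 - α) * δ * (geo i).dist a b)))) := by
  have h261 : Ineq261With (B6Lemma21Arith.c1Repaired d δ α) (geo i) δ α := (h21 i hH α hα0 hα1 h259).2
  have h263 : Ineq263With (B6Lemma21Arith.c1Repaired d δ α) (geo i) δ α :=
    ineq263With_of_261With htri hδ hα1.le h261
  have hαδ : 0 ≤ (1 - α) * δ := mul_nonneg (by linarith) hδ
  exact prop26_three_entries_of_291With blk _ δ α θ A (c1Repaired_nonneg d δ α) hA hθ hαδ htri hrefl hdnn h261 h263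
    hsmall hL hη D hD0 hinv h291 hDG0 hR

open Classical in
/-- **The end-to-end glueing (2.133) + (2.134) + (2.91) ⟹ (2.136) with the REPAIRED Lemma 2.1′ of the tree at the rate
½δ₂** (pv09's `B6Prop26Gluing.prop26_2136_of_2133_2134_lemma21` with `B6.Lemma21Printed` ↦ `Lemma21Repaired`).
[cite: Balaban1984PropagatorsII, Prop. 2.6 p.247; Lemma 2.1 p.234; repaired] -/
theorem prop26_2136_of_2133_2134_lemma21Repaired (d : ℕ) (δ₂ : ℝ) (hδ₂ : 0 ≤ δ₂) (geo : I → B6.Geometry)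
    (h21 : Lemma21Repaired d (δ₂ / 2) geo) (i : I) (htri : Triangle254 (geo i))
    (hrefl : ∀ y : (geo i).Site, (geo i).dist y y = 0) (hdnn : ∀ y y' : (geo i).Site, 0 ≤ (geo i).dist y y')
    (hH : (geo i).Hyp21_22) (α : ℝ) (hα0 : 0 < α) (hα1 : α < 1)
    (h259 : B6.Cond259 d (δ₂ / 2) α (geo i).R (geo i).M)
    {X : Type} [Fintype X] [DecidableEq X] (blk : X → (geo i).Site) (θ₀ A : ℝ) (P : (geo i).Site → ℝ)
    (hA : 0 ≤ A) (hP : ∀ y, 0 ≤ P y) (hθ₀ : 0 ≤ θ₀)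
    {C : Type} (D : Finset C) (S : C → Set (geo i).Site) (N : ℕ)
    (hN : ∀ a : (geo i).Site, (D.filter fun c => a ∈ S c).card ≤ N)
    (hsmall : (N : ℝ) ^ 2 * θ₀ * B6Lemma21Arith.c1Repaired d (δ₂ / 2) α < 1)
    (h : C → X → ℝ) (hsupp : ∀ c ∈ D, ∀ x, h c x ≠ 0 → blk x ∈ S c) (hle : ∀ c ∈ D, ∀ x, |h c x| ≤ 1)
    (Gl : C → Module.End ℝ (X → ℝ))
    (h2133 : ∀ c ∈ D,
      LocalMajorant blk (Gl c) (S c) (fun a b => A * P a * Real.exp (-(δ₂ / 2 * (geo i).dist a b))))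
    (Kt : C → C → Module.End ℝ (X → ℝ))
    (h2134 : ∀ c ∈ D, ∀ c' ∈ D,
      HasMajorant blk (Kt c c' * mulOp (h c')) (fun a b => θ₀ * Real.exp (-(δ₂ / 2 * (geo i).dist a b))))
    (hKout : ∀ c ∈ D, ∀ c' ∈ D, OutLoc blk (Kt c c') (S c))
    {G G0 R Δa : Module.End ℝ (X → ℝ)}
    (hG0 : G0 = ∑ c ∈ D, mulOp (h c) * Gl c * mulOp (h c))
    (hR : R = ∑ c ∈ D, ∑ c' ∈ D, Kt c c' * mulOp (h c'))
    (hinv : G * Δa = 1) (h291 : Δa * G0 = 1 - R) :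
    HasMajorant blk G (fun a b => (N * A) * B6Lemma21Arith.c1Repaired d (δ₂ / 2) α *
      (1 - (N : ℝ) ^ 2 * θ₀ * B6Lemma21Arith.c1Repaired d (δ₂ / 2) α)⁻¹ * P a *
      Real.exp (-(delta3 α δ₂ * (geo i).dist a b))) := by
  have h261 : Ineq261With (B6Lemma21Arith.c1Repaired d (δ₂ / 2) α) (geo i) (δ₂ / 2) α :=
    (h21 i hH α hα0 hα1 h259).2
  have h263 : Ineq263With (B6Lemma21Arith.c1Repaired d (δ₂ / 2) α) (geo i) (δ₂ / 2) α :=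
    ineq263With_of_261With htri (by linarith) hα1.le h261
  exact prop26_2136_of_2133_2134With blk _ δ₂ α θ₀ A P (c1Repaired_nonneg d (δ₂ / 2) α) hA hP hθ₀ hα1.le hδ₂ htri
    hrefl hdnn h261 h263 D S N hN hsmall h hsupp hle Gl h2133 Kt h2134 hKout hG0 hR hinv h291

/-- **Cor. 2.8 (first conjunct, in shape) with the REPAIRED Lemma 2.1′ of the tree** (pv01's
`B6Cor28.cor28_entries_of_lemma21` with `B6.Lemma21Printed` ↦ `Lemma21Repaired`; O(1) = C₁C₂L²c₁′²).
[cite: Balaban1984PropagatorsII, Cor. 2.8 p.249; Lemma 2.1 p.234; repaired] -/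
theorem cor28_entries_of_lemma21Repaired (d : ℕ) (δ₀ : ℝ) (hδ₀ : 0 ≤ δ₀) (geo : I → B6.Geometry)
    (h21 : Lemma21Repaired d δ₀ geo) (i : I) (htri : Triangle254 (geo i))
    (hH : (geo i).Hyp21_22) (α : ℝ) (hα0 : 0 < α) (hα1 : α < 1)
    (h259 : B6.Cond259 d δ₀ α (geo i).R (geo i).M) (hL : 1 ≤ (geo i).L) (hη : 0 < (geo i).eta)
    (hlarge : (geo i).L ^ (2 : ℝ) ≤ Real.exp (α * δ₀ * (geo i).R * (geo i).M))
    (hdist : ∀ y y', 0 ≤ (geo i).dist y y')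
    (K₁ : Fin 2 → (geo i).Site → (geo i).Site → ℝ) (K₂ : (geo i).Site → (geo i).Site → ℝ)
    (C₁ C₂ δ₃ δ₄' : ℝ) (hC₁ : 0 ≤ C₁) (hC₂ : 0 ≤ C₂) (hδ₃ : δ₀ + α * δ₀ ≤ δ₃) (hδ₄ : δ₀ ≤ δ₄')
    (hK₁ : ∀ n : Fin 2, KerBound136 (geo i).len (geo i).dist d (K₁ n) (2 - (n : ℝ)) C₁ δ₃)
    (hK₂ : KerBound149 (geo i).len (geo i).dist d K₂ C₂ δ₄') :
    ∀ (n : Fin 2) (y c : (geo i).Site), |compKer (geo i).len d (K₁ n) K₂ y c| ≤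
      C₁ * C₂ * (geo i).L ^ (2 : ℝ) * B6Lemma21Arith.c1Repaired d δ₀ α ^ 2 * (geo i).len y ^ (-(n : ℝ)) *
        (geo i).len c ^ (-(d : ℝ)) * Real.exp (-((1 - α) * δ₀ * (geo i).dist y c)) := by
  obtain ⟨h260, h261⟩ := h21 i hH α hα0 hα1 h259
  exact cor28_entries_of_261With (geo i) d _ δ₀ α hδ₀ hα1.le htri h260 h261 hL hη hlarge hdist K₁ K₂ C₁ C₂ δ₃
    δ₄' hC₁ hC₂ hδ₃ hδ₄ hK₁ hK₂

/-- **(2.88) with the REPAIRED Lemma 2.1′ of the tree** (pv01's `B6Cor28.ineq288_printed_of_lemma21` with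
`B6.Lemma21Printed` ↦ `Lemma21Repaired`; O(1) = C₁C₂C₃·L⁴·L^d·L·c₁′³, δ₂ = (1−α)δ).
[cite: Balaban1984PropagatorsII, (2.88) p.238; Lemma 2.1 p.234; repaired] -/
theorem ineq288_of_lemma21Repaired (d : ℕ) (δ : ℝ) (hδ : 0 ≤ δ) (geo : I → B6.Geometry)
    (h21 : Lemma21Repaired d δ geo) (i : I) (htri : Triangle254 (geo i))
    (hH : (geo i).Hyp21_22) (α : ℝ) (hα0 : 0 < α) (hα1 : α < 1)
    (h259 : B6.Cond259 d δ α (geo i).R (geo i).M) (hL : 1 ≤ (geo i).L) (hη : 0 < (geo i).eta)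
    (hl4 : (geo i).L ^ (4 : ℝ) ≤ Real.exp (α * δ * (geo i).R * (geo i).M))
    (hld : (geo i).L ^ (d : ℝ) ≤ Real.exp (α * δ * (geo i).R * (geo i).M))
    (hl1 : (geo i).L ^ (1 : ℝ) ≤ Real.exp (α * δ * (geo i).R * (geo i).M))
    (hdist : ∀ y y', 0 ≤ (geo i).dist y y')
    (K₁ K₂ K₃ : (geo i).Site → (geo i).Site → ℝ) (C₁ C₂ C₃ a b c' : ℝ)
    (hC₁ : 0 ≤ C₁) (hC₂ : 0 ≤ C₂) (hC₃ : 0 ≤ C₃)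
    (ha : δ + 2 * (α * δ) ≤ a) (hb : δ + α * δ ≤ b) (hc : δ + 2 * (α * δ) ≤ c')
    (hK₁ : ∀ y y₁, |K₁ y y₁| ≤ C₁ * (geo i).len y ^ (1 : ℝ) * Real.exp (-(a * (geo i).dist y y₁)))
    (hK₂ : ∀ y₁ y₂, |K₂ y₁ y₂| ≤ C₂ * (geo i).len y₁ ^ (-(4 : ℝ)) * (geo i).len y₂ ^ (-(d : ℝ)) *
      Real.exp (-(b * (geo i).dist y₁ y₂)))
    (hK₃ : ∀ y₂ y', |K₃ y₂ y'| ≤ C₃ * (geo i).len y' ^ (1 : ℝ) * Real.exp (-(c' * (geo i).dist y₂ y'))) :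
    Ineq288 (geo i) d K₁ K₂ K₃
      (C₁ * C₂ * C₃ * (geo i).L ^ (4 : ℝ) * (geo i).L ^ (d : ℝ) * (geo i).L ^ (1 : ℝ) *
        B6Lemma21Arith.c1Repaired d δ α ^ 3) ((1 - α) * δ) := by
  obtain ⟨h260, h261⟩ := h21 i hH α hα0 hα1 h259
  exact ineq288_printed_of_261With (geo i) d _ δ α hδ hα0 hα1.le htri h260 h261 hL hη hl4 hld hl1 hdist K₁ K₂ K₃ C₁
    C₂ C₃ a b c' hC₁ hC₂ hC₃ ha hb hc hK₁ hK₂ hK₃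

end Repaired

/-! ## §6. On the multi-level tower family: the Lemma-2.1 inputs of the chain DISCHARGED by name -/

section Tower

open B6LevelTower (TW twGeo twGeo_hyps266)
open B6TowerSums (Ktw Ktw_nonneg twGeo_ineq261With twGeo_ineq263With)

variable (d : ℕ) [NeZero d] (k a m L : ℕ) (η R : ℝ)

/-- **Prop. 2.6's chain ON THE (k+1)-LEVEL TOWER, Lemma 2.1 discharged** — for EVERY tower `twGeo d k a m L η R`
(d ≥ 1 levels of blocks of side a + 1, every height k, every L ≥ 1): the (2.61)/(2.63) inputs of `prop26_chain_2136With`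
at the rate ½δ₂ hold with the tower constant c = K_TW(α·½δ₂) (`B6TowerSums.twGeo_ineq261With`/`twGeo_ineq263With`,
uniform in k) and (2.54), d(y,y) = 0, d ≥ 0 hold by the realisation (`B6LevelTower.twGeo_hyps266`); hence for ANY
operators G, G₀, R on any finite lattice over the tower's 𝔅 with the (2.133)/(2.135)-majorants and G = G₀ + GR, under
the located smallness θ·K_TW < 1, G has the majorant A·K_TW·(1 − θK_TW)⁻¹·P(y)·e^{−δ₃d(y,y′)}.  On these geometries the
PRINTED c₁(α) is refuted (`B6Lemma21TowerD2`, GAPS G-B6-01b), so this is the non-vacuous form of the chain there.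
[cite: Balaban1984PropagatorsII, Prop. 2.6 (2.136), (2.141) p.247; Lemma 2.1 (2.61)–(2.63) p.234] -/
theorem prop26_chain_2136_tower (hL : 1 ≤ L) {δ₂ α θ A : ℝ} (hα0 : 0 < α) (hα : α ≤ 1) (hδ₂ : 0 < δ₂)
    (hA : 0 ≤ A) (hθ : 0 ≤ θ)
    {X : Type} [Fintype X] [DecidableEq X] (blk : X → (twGeo d k a m L η R).Site)
    (P : (twGeo d k a m L η R).Site → ℝ) (hP : ∀ y, 0 ≤ P y)
    (hsmall : θ * Ktw d L (α * (δ₂ / 2)) < 1)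
    {G G0 Rop : Module.End ℝ (X → ℝ)}
    (hG0 : HasMajorant blk G0 (fun y y' => A * P y * Real.exp (-(δ₂ / 2 * (twGeo d k a m L η R).dist y y'))))
    (hR : HasMajorant blk Rop (fun y y' => θ * Real.exp (-(δ₂ / 2 * (twGeo d k a m L η R).dist y y'))))
    (hfix : G = G0 + G * Rop) :
    HasMajorant blk G (fun y y' => A * Ktw d L (α * (δ₂ / 2)) * (1 - θ * Ktw d L (α * (δ₂ / 2)))⁻¹ * P y *
      Real.exp (-(delta3 α δ₂ * (twGeo d k a m L η R).dist y y'))) := by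
  have hrate : 0 < α * (δ₂ / 2) := mul_pos hα0 (by linarith)
  obtain ⟨htri, hrefl, hdnn⟩ := twGeo_hyps266 d k a m L η R
  have h261 := twGeo_ineq261With d k a m L η R hL hrate
  have h263 := twGeo_ineq263With d k a m L η R hL hrate (by linarith) hα
  have hc : 0 ≤ Ktw d L (α * (δ₂ / 2)) := Ktw_nonneg d L hrate (Nat.pos_of_ne_zero (NeZero.ne d))
  exact prop26_chain_2136With blk _ δ₂ α θ A P hc hA hP hθ hα hδ₂.le htri hrefl hdnn h261 h263 hsmall hG0 hR hfix

/-- **One entry of (2.136) for a left factor D ON THE (k+1)-LEVEL TOWER, Lemma 2.1 discharged** (rate δ > 0, any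
0 < α ≤ 1; constant c = K_TW(αδ)): from (2.91) `Δ_aG₀ = I − R`, `GΔ_a = I`, the (2.133)-majorant of DG₀ and the
(2.135)-majorant of R only. [cite: Balaban1984PropagatorsII, Prop. 2.6 (2.136) p.247; (2.91) p.239; Lemma 2.1 p.234] -/
theorem prop26_entry_of_291_tower (hL : 1 ≤ L) {δ α θ A : ℝ} (hα0 : 0 < α) (hα : α ≤ 1) (hδ : 0 < δ)
    (hA : 0 ≤ A) (hθ : 0 ≤ θ)
    {X : Type} [Fintype X] [DecidableEq X] (blk : X → (twGeo d k a m L η R).Site)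
    (P : (twGeo d k a m L η R).Site → ℝ) (hP : ∀ y, 0 ≤ P y)
    (hsmall : θ * Ktw d L (α * δ) < 1)
    {G G0 Rop Δa : Module.End ℝ (X → ℝ)} (D : Module.End ℝ (X → ℝ))
    (hinv : G * Δa = 1) (h291 : Δa * G0 = 1 - Rop)
    (hDG0 : HasMajorant blk (D * G0) (fun y y' => A * P y * Real.exp (-(δ * (twGeo d k a m L η R).dist y y'))))
    (hR : HasMajorant blk Rop (fun y y' => θ * Real.exp (-(δ * (twGeo d k a m L η R).dist y y')))) :
    HasMajorant blk (D * G) (fun y y' => A * Ktw d L (α * δ) * (1 - θ * Ktw d L (α * δ))⁻¹ * P y *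
      Real.exp (-((1 - α) * δ * (twGeo d k a m L η R).dist y y'))) := by
  have hrate : 0 < α * δ := mul_pos hα0 hδ
  obtain ⟨htri, hrefl, hdnn⟩ := twGeo_hyps266 d k a m L η R
  have h261 := twGeo_ineq261With d k a m L η R hL hrate
  have h263 := twGeo_ineq263With d k a m L η R hL hrate hδ.le hα
  have hc : 0 ≤ Ktw d L (α * δ) := Ktw_nonneg d L hrate (Nat.pos_of_ne_zero (NeZero.ne d))
  have hαδ : 0 ≤ (1 - α) * δ := mul_nonneg (by linarith) hδ.le
  exact prop26_entry_of_291With blk _ δ α θ A P hc hA hP hθ hαδ htri hrefl hdnn h261 h263 hsmall D hinv h291 hDG0 hR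

/-- **The two convolution inputs of Cor. 2.8 / (2.88) ON THE (k+1)-LEVEL TOWER, Lemma 2.1 discharged**: (2.63) with one
and with two intermediate points at any rate δ₀ ≥ 0, 0 < α ≤ 1, constants K_TW(αδ₀)² and K_TW(αδ₀)³ — the `Conv263` /
`Conv3` hypotheses of `B6Cor28.cor28_first_conjunct_shape` / `B6Cor28.ineq288_kernel` hold on every tower.
[cite: Balaban1984PropagatorsII, Lemma 2.1 (2.63) p.234; Cor. 2.8 p.249; (2.88) p.238] -/
theorem cor28_conv_tower (hL : 1 ≤ L) {δ₀ α : ℝ} (hα0 : 0 < α) (hα : α ≤ 1) (hδ₀ : 0 < δ₀) :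
    B6Cor28.Conv263 (twGeo d k a m L η R).dist δ₀ (Ktw d L (α * δ₀) ^ 2) ((1 - α) * δ₀) ∧
    B6Cor28.Conv3 (twGeo d k a m L η R).dist δ₀ (Ktw d L (α * δ₀) ^ 3) ((1 - α) * δ₀) := by
  have hrate : 0 < α * δ₀ := mul_pos hα0 hδ₀
  have h263 := twGeo_ineq263With d k a m L η R hL hrate hδ₀.le hα
  exact ⟨conv263_of_ineq263With _ _ δ₀ α h263, conv3_of_ineq263With _ _ δ₀ α h263⟩

open B6Prop26Gluing (mulOp LocalMajorant OutLoc) in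
open Classical in
/-- **The end-to-end glueing (2.133) + (2.134) + (2.91) ⟹ (2.136) ON THE (k+1)-LEVEL TOWER, Lemma 2.1 discharged**
(v1.1, seat r03 gen 8): for EVERY tower `twGeo d k a m L η R` (L ≥ 1), every rate δ₂ > 0 and 0 < α ≤ 1, the
(2.61)/(2.63) inputs of `prop26_2136_of_2133_2134With` at the rate ½δ₂ hold with c = K_TW(α·½δ₂)
(`B6TowerSums.twGeo_ineq261With`/`twGeo_ineq263With`, uniform in the height k) and (2.54), d(y,y) = 0, d ≥ 0 by
`B6LevelTower.twGeo_hyps266`; hence for ANY family of boxes 𝒟 with reaches S_□ of overlap number N over the tower's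
𝔅, partition functions h_□ (|h_□| ≤ 1, supported in S_□), box operators G_□ with the (2.133)-type local bound
A·P(y)·e^{−½δ₂d} on S_□, pair operators K_{□,□′} output-localised to S_□ with (2.134) at θ₀, G₀ = Σ_□ h_□G_□h_□,
R = Σ K_{□,□′}h_{□′}, (2.91) and GΔ_a = I, under the located smallness N²θ₀·K_TW < 1:
|G(x,x′)| ≤ (N·A)·K_TW·(1 − N²θ₀K_TW)⁻¹·P(y)·e^{−δ₃d(y,y′)}, δ₃ = `delta3 α δ₂` — the printed glueing argument of
p. 247 made unconditional in its Lemma-2.1 input on the geometries where the printed c₁(α) is refuted (G-B6-01b).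
[cite: Balaban1984PropagatorsII, Prop. 2.6 (2.136) p.247; (2.91) p.239; (2.133)–(2.135) p.247; Lemma 2.1 (2.61)–(2.63) p.234] -/
theorem prop26_2136_of_2133_2134_tower (hL : 1 ≤ L) {δ₂ α θ₀ A : ℝ} (hα0 : 0 < α) (hα : α ≤ 1) (hδ₂ : 0 < δ₂)
    (hA : 0 ≤ A) (hθ₀ : 0 ≤ θ₀)
    {X : Type} [Fintype X] [DecidableEq X] (blk : X → (twGeo d k a m L η R).Site)
    (P : (twGeo d k a m L η R).Site → ℝ) (hP : ∀ y, 0 ≤ P y)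
    {C : Type} (D : Finset C) (S : C → Set (twGeo d k a m L η R).Site) (N : ℕ)
    (hN : ∀ y : (twGeo d k a m L η R).Site, (D.filter fun i => y ∈ S i).card ≤ N)
    (hsmall : (N : ℝ) ^ 2 * θ₀ * Ktw d L (α * (δ₂ / 2)) < 1)
    (h : C → X → ℝ) (hsupp : ∀ i ∈ D, ∀ x, h i x ≠ 0 → blk x ∈ S i) (hle : ∀ i ∈ D, ∀ x, |h i x| ≤ 1)
    (Gl : C → Module.End ℝ (X → ℝ))
    (h2133 : ∀ i ∈ D, LocalMajorant blk (Gl i) (S i)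
      (fun y y' => A * P y * Real.exp (-(δ₂ / 2 * (twGeo d k a m L η R).dist y y'))))
    (Kt : C → C → Module.End ℝ (X → ℝ))
    (h2134 : ∀ i ∈ D, ∀ i' ∈ D, HasMajorant blk (Kt i i' * mulOp (h i'))
      (fun y y' => θ₀ * Real.exp (-(δ₂ / 2 * (twGeo d k a m L η R).dist y y'))))
    (hKout : ∀ i ∈ D, ∀ i' ∈ D, OutLoc blk (Kt i i') (S i))
    {G G0 Rop Δa : Module.End ℝ (X → ℝ)}
    (hG0 : G0 = ∑ i ∈ D, mulOp (h i) * Gl i * mulOp (h i))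
    (hR : Rop = ∑ i ∈ D, ∑ i' ∈ D, Kt i i' * mulOp (h i'))
    (hinv : G * Δa = 1) (h291 : Δa * G0 = 1 - Rop) :
    HasMajorant blk G (fun y y' => (N * A) * Ktw d L (α * (δ₂ / 2)) *
      (1 - (N : ℝ) ^ 2 * θ₀ * Ktw d L (α * (δ₂ / 2)))⁻¹ * P y *
      Real.exp (-(delta3 α δ₂ * (twGeo d k a m L η R).dist y y'))) := by
  have hrate : 0 < α * (δ₂ / 2) := mul_pos hα0 (by linarith)
  obtain ⟨htri, hrefl, hdnn⟩ := twGeo_hyps266 d k a m L η R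
  have h261 := twGeo_ineq261With d k a m L η R hL hrate
  have h263 := twGeo_ineq263With d k a m L η R hL hrate (by linarith) hα
  have hc : 0 ≤ Ktw d L (α * (δ₂ / 2)) := Ktw_nonneg d L hrate (Nat.pos_of_ne_zero (NeZero.ne d))
  exact prop26_2136_of_2133_2134With blk _ δ₂ α θ₀ A P hc hA hP hθ₀ hα hδ₂.le htri hrefl hdnn h261 h263 D S N hN
    hsmall h hsupp hle Gl h2133 Kt h2134 hKout hG0 hR hinv h291

end Tower

end Literature.MathematicalPhysics.QuantumFieldTheory.Balaban1983to89.B6Prop26ChainGeneric
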